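import Literature.Algebra.Semigroups.FullTransformationGreen

/-!
# One-sided ideals of `𝒯ₙ`: antichains of subsets and of partitions

Source: O. Ganyushkin, V. Mazorchuk, *Classical Finite Transformation Semigroups*, Algebra and
Applications 9, Springer (2009) [GanyushkinMazorchuk2009], §4.3 "Arbitrary ideals in `𝒯ₙ`,
`𝒫𝒯ₙ`, and `ℐ𝒮ₙ`": Theorem 4.3.2 (right ideals) and Theorem 4.3.5 (left ideals) for the full
transformation monoid `𝒯(X) = (X → X, ∘)`.

Right ideals.  For a family `L` of subsets of `X` put `𝓘_L = {α : ∃ A ∈ L, im α ⊆ A}`.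
Theorem 4.3.2: (i) `𝓘_L` is a right ideal; (ii) distinct antichains give distinct `𝓘_L`;
(iii) every right ideal is `𝓘_L` for the antichain `L` of maximal images
(`comp_mem_idealOfSubsets`, `antichain_eq_of_idealOfSubsets_eq`,
`exists_antichain_eq_idealOfSubsets`).  In `𝒯ₙ` images are nonempty, so the antichains range
over nonempty subsets (the book's `𝓑(N)` statement is for all three semigroups at once).

Left ideals.  The book orders the partitions `Partₙ` by `ρ ≤ τ` iff every block of `ρ` is a union
of blocks of `τ`, i.e. iff `π_ρ ⊇ π_τ`; with partitions as Mathlib `Setoid`s this is the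
*reverse* of Mathlib's order, `ρ_α = Setoid.ker α`, and `ρ_α ≤ ρ` reads `ρ ≤ Setoid.ker α`.
For a family `L` of setoids put `_L𝓘 = {α : ∃ ρ ∈ L, ρ ≤ Setoid.ker α}`.  Theorem 4.3.5: `_L𝓘` is
a left ideal, distinct antichains give distinct ideals, and every left ideal is `_L𝓘` for the
antichain of extremal kernels (`comp_mem_idealOfSetoids`, `antichain_eq_of_idealOfSetoids_eq`,
`exists_antichain_eq_idealOfSetoids`).
-/

namespace Literature.Algebra.Semigroups.FullTransformation

open Function Set

variable {X : Type*}

/-! ### Theorem 4.3.2: right ideals -/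

/-- **Theorem 4.3.2 (i)** (case `𝒯ₙ`): for any family `L` of subsets,
`𝓘_L = {α : ∃ A ∈ L, im α ⊆ A}` is a right ideal of `𝒯(X)` (closed under `α ↦ αμ`).
[cite: GanyushkinMazorchuk2009, Theorem 4.3.2 (i)] -/
theorem comp_mem_idealOfSubsets (L : Set (Set X)) {α : X → X}
    (hα : α ∈ {α : X → X | ∃ A ∈ L, range α ⊆ A}) (μ : X → X) :
    α ∘ μ ∈ {α : X → X | ∃ A ∈ L, range α ⊆ A} := by
  obtain ⟨A, hA, h⟩ := hα
  exact ⟨A, hA, (range_comp_subset_range μ α).trans h⟩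

/-- Every nonempty subset `A` is the image of some `α ∈ 𝒯(X)` (used in Theorem 4.3.2 (ii)).
[cite: GanyushkinMazorchuk2009, Theorem 4.3.2 (ii)] -/
theorem exists_range_eq {A : Set X} (hA : A.Nonempty) : ∃ α : X → X, range α = A := by
  classical
  obtain ⟨a, ha⟩ := hA
  refine ⟨fun x => if x ∈ A then x else a, Subset.antisymm ?_ fun x hx => ⟨x, by simp [hx]⟩⟩
  rintro _ ⟨x, rfl⟩
  dsimp only
  split_ifs with hx
  · exact hx
  · exact ha

/-- The asymmetric half of Theorem 4.3.2 (ii): if `A ∈ L₁ \ L₂` for antichains `L₁, L₂` of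
nonempty subsets then `𝓘_{L₁} ≠ 𝓘_{L₂}` (Cases 1 and 2 of the printed proof).
[cite: GanyushkinMazorchuk2009, Theorem 4.3.2 (ii)] -/
theorem idealOfSubsets_ne_of_mem_diff {L₁ L₂ : Set (Set X)} (h₁ : IsAntichain (· ⊆ ·) L₁)
    (hne₂ : ∀ A ∈ L₂, A.Nonempty) {A : Set X} (hA : A.Nonempty) (hA₁ : A ∈ L₁)
    (hA₂ : A ∉ L₂) :
    {α : X → X | ∃ A ∈ L₁, range α ⊆ A} ≠ {α : X → X | ∃ A ∈ L₂, range α ⊆ A} := by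
  intro heq
  obtain ⟨α, hα⟩ := exists_range_eq hA
  have hα₁ : α ∈ {α : X → X | ∃ A ∈ L₁, range α ⊆ A} := ⟨A, hA₁, hα.le⟩
  rw [heq] at hα₁
  obtain ⟨B, hB₂, hAB⟩ := hα₁
  rw [hα] at hAB
  -- `A ⊆ B ∈ L₂`, `B ≠ A`; an element with image `B` lies in `𝓘_{L₂}` hence in `𝓘_{L₁}`
  have hBA : B ≠ A := fun h => hA₂ (h ▸ hB₂)
  obtain ⟨β, hβ⟩ := exists_range_eq (hne₂ B hB₂)
  have hβ₂ : β ∈ {α : X → X | ∃ A ∈ L₂, range α ⊆ A} := ⟨B, hB₂, hβ.le⟩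
  rw [← heq] at hβ₂
  obtain ⟨C, hC₁, hBC⟩ := hβ₂
  rw [hβ] at hBC
  -- `A ⊆ B ⊆ C` with `A, C ∈ L₁` forces `A = C`, hence `A = B`
  have hAC : A = C := h₁.eq hA₁ hC₁ (hAB.trans hBC)
  exact hBA (Subset.antisymm (hAC ▸ hBC) hAB)

/-- **Theorem 4.3.2 (ii)** (case `𝒯ₙ`): different antichains `L₁ ≠ L₂` of nonempty subsets give
different right ideals `𝓘_{L₁} ≠ 𝓘_{L₂}`. [cite: GanyushkinMazorchuk2009, Theorem 4.3.2 (ii)] -/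
theorem antichain_eq_of_idealOfSubsets_eq {L₁ L₂ : Set (Set X)} (h₁ : IsAntichain (· ⊆ ·) L₁)
    (h₂ : IsAntichain (· ⊆ ·) L₂) (hne₁ : ∀ A ∈ L₁, A.Nonempty) (hne₂ : ∀ A ∈ L₂, A.Nonempty)
    (heq : {α : X → X | ∃ A ∈ L₁, range α ⊆ A} = {α : X → X | ∃ A ∈ L₂, range α ⊆ A}) :
    L₁ = L₂ := by
  by_contra hne
  rcases em (∃ A ∈ L₁, A ∉ L₂) with ⟨A, hA₁, hA₂⟩ | h
  · exact idealOfSubsets_ne_of_mem_diff h₁ hne₂ (hne₁ A hA₁) hA₁ hA₂ heq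
  · push Not at h
    obtain ⟨A, hA₂, hA₁⟩ : ∃ A ∈ L₂, A ∉ L₁ := by
      by_contra h'
      push Not at h'
      exact hne (Subset.antisymm h h')
    exact idealOfSubsets_ne_of_mem_diff h₂ hne₁ (hne₂ A hA₂) hA₂ hA₁ heq.symm

/-- **Theorem 4.3.2 (iii)** (case `𝒯ₙ`, `X` finite and nonempty): every right ideal `I` of
`𝒯(X)` is `𝓘_L` for an antichain `L` of nonempty subsets — the maximal elements of
`{im α : α ∈ I}` (Theorem 4.2.1 gives `𝓘_L ⊆ I`).
[cite: GanyushkinMazorchuk2009, Theorem 4.3.2 (iii)] -/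
theorem exists_antichain_eq_idealOfSubsets [Finite X] [Nonempty X] {I : Set (X → X)}
    (hI : ∀ α ∈ I, ∀ μ : X → X, α ∘ μ ∈ I) :
    ∃ L : Set (Set X), IsAntichain (· ⊆ ·) L ∧ (∀ A ∈ L, A.Nonempty) ∧
      I = {α : X → X | ∃ A ∈ L, range α ⊆ A} := by
  let K : Set (Set X) := (fun α => range α) '' I
  have hK : K.Finite := I.toFinite.image _
  refine ⟨{A | Maximal (· ∈ K) A}, ?_, ?_, Subset.antisymm ?_ ?_⟩
  · intro A hA B hB hAB hle
    exact hAB (Subset.antisymm hle (hA.2 hB.1 hle))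
  · rintro A ⟨⟨α, -, rfl⟩, -⟩
    exact range_nonempty α
  · intro α hα
    obtain ⟨B, hAB, hB⟩ := hK.exists_le_maximal (a := range α) ⟨α, hα, rfl⟩
    exact ⟨B, hB, hAB⟩
  · rintro β ⟨A, ⟨⟨α, hα, rfl⟩, -⟩, hβA⟩
    obtain ⟨γ, rfl⟩ := (exists_eq_comp_iff_range_subset α β).2 hβA
    exact hI α hα γ

/-! ### Theorem 4.3.5: left ideals -/

/-- The kernel partition only coarsens under left multiplication: `ρ_{νμ} ≤ ρ_μ`, i.e.
`Setoid.ker μ ≤ Setoid.ker (ν ∘ μ)` (first sentence of the proof of Theorem 4.3.5).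
[cite: GanyushkinMazorchuk2009, Theorem 4.3.5] -/
theorem ker_le_ker_comp (ν μ : X → X) : Setoid.ker μ ≤ Setoid.ker (ν ∘ μ) := by
  intro x y h
  rw [Setoid.ker_def] at h ⊢
  simp only [comp_apply, h]

/-- **Theorem 4.3.5**, first part (case `𝒯ₙ`): for any family `L` of partitions (setoids),
`_L𝓘 = {α : ∃ ρ ∈ L, ρ_α ≤ ρ}` — in Mathlib's order `ρ ≤ Setoid.ker α` — is a left ideal
of `𝒯(X)`. [cite: GanyushkinMazorchuk2009, Theorem 4.3.5] -/
theorem comp_mem_idealOfSetoids (L : Set (Setoid X)) {α : X → X}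
    (hα : α ∈ {α : X → X | ∃ ρ ∈ L, ρ ≤ Setoid.ker α}) (ν : X → X) :
    ν ∘ α ∈ {α : X → X | ∃ ρ ∈ L, ρ ≤ Setoid.ker α} := by
  obtain ⟨ρ, hρ, h⟩ := hα
  exact ⟨ρ, hρ, h.trans (ker_le_ker_comp ν α)⟩

/-- Every partition is the kernel partition of some `α ∈ 𝒯(X)` (pick a representative in each
block), used in Theorem 4.3.5. [cite: GanyushkinMazorchuk2009, Theorem 4.3.5] -/
theorem exists_ker_eq (ρ : Setoid X) : ∃ α : X → X, Setoid.ker α = ρ := by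
  refine ⟨fun x => (Quotient.mk ρ x).out, Setoid.ext fun x y => ?_⟩
  rw [Setoid.ker_def, Quotient.out_inj, Quotient.eq]

/-- `β ∈ 𝒯(X)α` iff `Setoid.ker α ≤ Setoid.ker β` (Theorem 4.2.4 in the language of setoids).
[cite: GanyushkinMazorchuk2009, Theorem 4.2.4] -/
theorem exists_eq_comp_left_iff_ker_le (α β : X → X) :
    (∃ γ : X → X, β = γ ∘ α) ↔ Setoid.ker α ≤ Setoid.ker β := by
  rw [exists_eq_comp_left_iff, Setoid.le_def]
  simp only [Setoid.ker_def]

/-- The asymmetric half of Theorem 4.3.5's injectivity: if `ρ ∈ L₁ \ L₂` for antichains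
`L₁, L₂` of setoids then `_{L₁}𝓘 ≠ _{L₂}𝓘` (the argument of Theorem 4.3.2 (ii) with images
replaced by kernel partitions). [cite: GanyushkinMazorchuk2009, Theorem 4.3.5] -/
theorem idealOfSetoids_ne_of_mem_diff {L₁ L₂ : Set (Setoid X)} (h₁ : IsAntichain (· ≤ ·) L₁)
    {ρ : Setoid X} (hρ₁ : ρ ∈ L₁) (hρ₂ : ρ ∉ L₂) :
    {α : X → X | ∃ ρ ∈ L₁, ρ ≤ Setoid.ker α} ≠ {α : X → X | ∃ ρ ∈ L₂, ρ ≤ Setoid.ker α} := by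
  intro heq
  obtain ⟨α, hα⟩ := exists_ker_eq ρ
  have hα₁ : α ∈ {α : X → X | ∃ ρ ∈ L₁, ρ ≤ Setoid.ker α} := ⟨ρ, hρ₁, hα.ge⟩
  rw [heq] at hα₁
  obtain ⟨τ, hτ₂, hτρ⟩ := hα₁
  rw [hα] at hτρ
  have hτne : τ ≠ ρ := fun h => hρ₂ (h ▸ hτ₂)
  obtain ⟨β, hβ⟩ := exists_ker_eq τ
  have hβ₂ : β ∈ {α : X → X | ∃ ρ ∈ L₂, ρ ≤ Setoid.ker α} := ⟨τ, hτ₂, hβ.ge⟩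
  rw [← heq] at hβ₂
  obtain ⟨κ, hκ₁, hκτ⟩ := hβ₂
  rw [hβ] at hκτ
  -- `κ ≤ τ ≤ ρ` with `κ, ρ ∈ L₁` forces `κ = ρ`, hence `τ = ρ`
  have hκρ : κ = ρ := h₁.eq hκ₁ hρ₁ (hκτ.trans hτρ)
  exact hτne (le_antisymm hτρ (hκρ ▸ hκτ))

/-- **Theorem 4.3.5**, injectivity (case `𝒯ₙ`): different antichains of partitions give
different left ideals. [cite: GanyushkinMazorchuk2009, Theorem 4.3.5] -/
theorem antichain_eq_of_idealOfSetoids_eq {L₁ L₂ : Set (Setoid X)} (h₁ : IsAntichain (· ≤ ·) L₁)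
    (h₂ : IsAntichain (· ≤ ·) L₂)
    (heq : {α : X → X | ∃ ρ ∈ L₁, ρ ≤ Setoid.ker α} = {α : X → X | ∃ ρ ∈ L₂, ρ ≤ Setoid.ker α}) :
    L₁ = L₂ := by
  by_contra hne
  rcases em (∃ ρ ∈ L₁, ρ ∉ L₂) with ⟨ρ, hρ₁, hρ₂⟩ | h
  · exact idealOfSetoids_ne_of_mem_diff h₁ hρ₁ hρ₂ heq
  · push Not at h
    obtain ⟨ρ, hρ₂, hρ₁⟩ : ∃ ρ ∈ L₂, ρ ∉ L₁ := by
      by_contra h'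
      push Not at h'
      exact hne (Subset.antisymm h h')
    exact idealOfSetoids_ne_of_mem_diff h₂ hρ₂ hρ₁ heq.symm

/-- **Theorem 4.3.5**, surjectivity (case `𝒯ₙ`, `X` finite): every left ideal `I` of `𝒯(X)`
is `_L𝓘` for an antichain `L` of partitions — the maximal kernel partitions (in the book's
order; minimal `Setoid.ker α`, `α ∈ I`, in Mathlib's), using Theorem 4.2.4 for `_L𝓘 ⊆ I`.
[cite: GanyushkinMazorchuk2009, Theorem 4.3.5] -/
theorem exists_antichain_eq_idealOfSetoids [Finite X] {I : Set (X → X)}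
    (hI : ∀ α ∈ I, ∀ ν : X → X, ν ∘ α ∈ I) :
    ∃ L : Set (Setoid X), IsAntichain (· ≤ ·) L ∧
      I = {α : X → X | ∃ ρ ∈ L, ρ ≤ Setoid.ker α} := by
  let K : Set (Setoid X) := (fun α => Setoid.ker α) '' I
  have hK : K.Finite := I.toFinite.image _
  refine ⟨{ρ | Minimal (· ∈ K) ρ}, ?_, Subset.antisymm ?_ ?_⟩
  · intro ρ hρ τ hτ hρτ hle
    exact hρτ (le_antisymm hle (hτ.2 hρ.1 hle))
  · intro α hα
    obtain ⟨ρ, hρα, hρ⟩ := hK.exists_le_minimal (a := Setoid.ker α) ⟨α, hα, rfl⟩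
    exact ⟨ρ, hρ, hρα⟩
  · rintro β ⟨ρ, ⟨⟨α, hα, rfl⟩, -⟩, hρβ⟩
    obtain ⟨γ, rfl⟩ := (exists_eq_comp_left_iff_ker_le α β).2 hρβ
    exact hI α hα γ

end Literature.Algebra.Semigroups.FullTransformation
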